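import Literature.Computability.Complexity.CookLevinTableau
import Literature.Computability.Complexity.Nondeterministic
import HarnessLib

/-!
# Membership in an `NP` language as solvability of the Cook–Levin clause families

Topic `Literature/Computability/Complexity` (used by the hard direction of Fagin's theorem,
`NP_subset_eso`, `Fagin.lean`): the MACHINE-FREE restatement of `x ∈ L` for `L ∈ NP` over the
tree's classes. `CookLevinTableau.lean` proves that `M` accepts `⟨x, u⟩` for some short
certificate `u` iff the clause set `Tableau.clauses M P T x` is satisfiable
(`Tableau.satisfiable_tableau_iff`; Sipser 2012, Thm. 7.37; Cook 1971, Thm. 1). Here: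

* `Tableau.ClausesHold M x P T τ` — the clause set SPELLED OUT family by family as a
  proposition about an assignment `τ` of the block variables (bits of `x` in the start row;
  initial control, separator `01`, free certificate cells, empty tail; the tabulated local rules
  `topF`/`intF` of `TableauStep.lean`; empty bottom cells; exactly one value per block; the
  accepting block), and `Tableau.clausesHold_iff` — it is equivalent to
  `∀ cl ∈ clauses M P T x, cl` holds under `τ`;
* `Tableau.exists_clausesHold_iff` — hence (with `satisfiable_tableau_iff`) solvability of the
  families is acceptance of some certificate;
* `exists_clausesHold_of_mem_NP` — **for `L ∈ NP` there are a machine `M` and polynomials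
  `p, q` with `x ∈ L ↔ ∃ τ, ClausesHold M x (p |x|) (q (2|x| + 2 + p |x|)) τ`** (unpacking
  `NP = polyExists P` and `mem_P_iff_holds`).

This is the form of acceptance that an `∃SO` sentence can express: the families are indexed
by rows `t ≤ T` and blocks `J ≤ S₁` (numbers polynomial in `|x|`) and by finitely many values.

## References

* M. Sipser, *Introduction to the Theory of Computation*, 3rd ed., 2012, Thm. 7.37 (proof:
  `φ_cell ∧ φ_start ∧ φ_move ∧ φ_accept`).
* S. A. Cook, *The complexity of theorem-proving procedures*, STOC 1971, Thm. 1.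
* L. Libkin, *Elements of Finite Model Theory*, Springer 2004, proof of Thm. 9.6 (p. 171: the
  sentences stating that the tape and head predicates "respect the transitions of `M`").
-/

namespace Literature.Computability.Complexity

namespace Tableau

open Turing _root_.Computability

variable (M : TM2ComputableAux Bool Bool)

attribute [local instance] Turing.FinTM2.kFin Turing.FinTM2.ΛFin Turing.FinTM2.σFin
  Turing.FinTM2.Γk₀Fin

section Families

variable (x : List Bool) (P T : ℕ)

local notation "n" => x.length
local notation "d" => dM M
local notation "β" => blk M (List.length x) P T

/-- **The Cook–Levin clause families as a proposition** about an assignment `τ` of the block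
variables "block `b` holds value `v`" (in the order: bits of `x`, start row, top rule, interior
rule, bottom, exactly-one, accept). This is a DEFINITION — a predicate in `M, x, P, T, τ` to be
*solved* for `τ` (`exists_clausesHold_iff`), characterised clause-by-clause by `clausesHold_iff`;
it is not a closed statement and has no discharge (`exists_not_clausesHold`: the constant-`false`
assignment violates it). [Sipser 2012, Thm. 7.37 (proof)] [folklore] -/
def ClausesHold (τ : TVar M → Bool) : Prop :=
  (∀ (i : ℕ) (b : Bool), x[i]? = some b →
      τ (β 0 (2 * i + 1), symVal M b) = true ∧ τ (β 0 (2 * i + 2), symVal M b) = true) ∧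
  (τ (β 0 0, ctrlVal M) = true ∧ τ (β 0 (2 * n + 1), symVal M false) = true ∧
      τ (β 0 (2 * n + 2), symVal M true) = true) ∧
  (∀ j : ℕ, j < P →
      (τ (β 0 (2 * n + 3 + j), symVal M false) = true ∨ τ (β 0 (2 * n + 3 + j), symVal M true) = true ∨
        τ (β 0 (2 * n + 3 + j), noneVal M.tm) = true) ∧
      (τ (β 0 (2 * n + 3 + j), noneVal M.tm) = true → τ (β 0 (2 * n + 4 + j), noneVal M.tm) = true)) ∧
  (∀ j : ℕ, j < d * T + 3 * d → τ (β 0 (NN n P + 1 + j), noneVal M.tm) = true) ∧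
  (∀ t : ℕ, t < T → ∀ (a : Fin (3 * d + 1) → Val M.tm) (r : Fin (2 * d + 1)),
      (∀ s : Fin (3 * d + 1), τ (β t s, a s) = true) → τ (β (t + 1) r, topF d a r) = true) ∧
  (∀ t : ℕ, t < T → ∀ j : ℕ, j < NN n P + d * T →
      ∀ (h : Fin (d + 1) → Val M.tm) (nb : Fin (2 * d + 1) → Val M.tm),
        (∀ s : Fin (d + 1), τ (β t s, h s) = true) →
        (∀ s : Fin (2 * d + 1), τ (β t (d + 1 + j + s), nb s) = true) →
          τ (β (t + 1) (2 * d + 1 + j), intF d h nb) = true) ∧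
  (∀ t : ℕ, t < T → ∀ r : ℕ, r < d →
      τ (β (t + 1) (NN n P + d * T + 2 * d + 1 + r), noneVal M.tm) = true) ∧
  (∀ t : ℕ, t ≤ T → ∀ J : ℕ, J ≤ S1 M n P T →
      (∃ v, τ (β t J, v) = true) ∧ ∀ v v', v ≠ v' → ¬ (τ (β t J, v) = true ∧ τ (β t J, v') = true)) ∧
  τ (β T 1, accVal M) = true

/-- **The families are the clause set**: `ClausesHold` iff every clause of `clauses M P T x`
holds. [Sipser 2012, Thm. 7.37 (proof)] [folklore] -/
theorem clausesHold_iff (τ : TVar M → Bool) :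
    ClausesHold M x P T τ ↔ ∀ cl ∈ clauses M P T x, HClause.Holds τ cl := by
  classical
  have unit : ∀ v : TVar M, HClause.Holds τ ([], [v]) ↔ τ v = true := HClause.holds_unit τ
  constructor
  · rintro ⟨hbit, ⟨hc, hs0, hs1⟩, hcert, htail, htop, hint, hbot, hcell, hacc⟩ cl hcl
    unfold clauses xClauses nClauses at hcl
    simp only [List.mem_append, List.mem_flatMap, List.mem_range, List.mem_cons,
      List.mem_nil_iff, or_false] at hcl
    rcases hcl with ⟨⟨b, i⟩, hbi, hcl⟩ | (((hcl | ⟨t, ht, hcl⟩) | ⟨t, ht, J, hJ, hcl⟩) | rfl)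
    · -- bits of `x`
      have hb : x[i]? = some b := List.mk_mem_zipIdx_iff_getElem?.1 hbi
      simp only [bitClauses, List.mem_cons, List.mem_nil_iff, or_false] at hcl
      rcases hcl with rfl | rfl
      · exact (unit _).2 (hbit i b hb).1
      · exact (unit _).2 (hbit i b hb).2
    · -- start row
      simp only [startClauses, List.mem_append, List.mem_cons, List.mem_nil_iff, or_false,
        List.mem_flatMap, List.mem_range, List.mem_map] at hcl
      rcases hcl with ((rfl | rfl | rfl) | ⟨j, hj, hcl⟩) | ⟨j, hj, rfl⟩
      · exact (unit _).2 hc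
      · exact (unit _).2 hs0
      · exact (unit _).2 hs1
      · rcases hcl with rfl | rfl
        · intro _
          rcases (hcert j hj).1 with h | h | h
          · exact ⟨_, by simp, h⟩
          · exact ⟨_, by simp, h⟩
          · exact ⟨_, by simp, h⟩
        · intro hpre
          exact ⟨_, List.mem_singleton.2 rfl, (hcert j hj).2 (hpre _ (List.mem_singleton.2 rfl))⟩
      · exact (unit _).2 (htail j hj)
    · -- move clauses of row `t < T`
      simp only [topClauses, intClauses, botClauses, List.mem_flatMap, List.mem_map,
        List.mem_range] at hcl
      rcases hcl with (⟨a, -, r, -, rfl⟩ | ⟨j, hj, h, -, nb, -, rfl⟩) | ⟨r, hr, rfl⟩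
      · intro hpre
        refine ⟨_, List.mem_singleton.2 rfl, htop t ht a r fun s => ?_⟩
        exact hpre _ (List.mem_map.2 ⟨s, List.mem_finRange _, rfl⟩)
      · intro hpre
        refine ⟨_, List.mem_singleton.2 rfl, hint t ht j hj h nb (fun s => ?_) (fun s => ?_)⟩
        · exact hpre _ (List.mem_append_left _ (List.mem_map.2 ⟨s, List.mem_finRange _, rfl⟩))
        · exact hpre _ (List.mem_append_right _ (List.mem_map.2 ⟨s, List.mem_finRange _, rfl⟩))
      · exact (unit _).2 (hbot t ht r hr)
    · -- exactly-one clauses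
      simp only [cellClauses, List.mem_cons, List.mem_flatMap] at hcl
      rcases hcl with rfl | ⟨v, -, v', -, hcl⟩
      · intro _
        obtain ⟨v, hv⟩ := (hcell t (by omega) J (by omega)).1
        exact ⟨_, List.mem_map.2 ⟨_, mem_allVals M _, rfl⟩, hv⟩
      · by_cases hvv : v = v'
        · rw [if_pos hvv] at hcl; simp at hcl
        · rw [if_neg hvv] at hcl
          simp only [List.mem_singleton] at hcl
          subst hcl
          intro hpre
          exact absurd ⟨hpre (β t J, v) (by simp), hpre (β t J, v') (by simp)⟩
            ((hcell t (by omega) J (by omega)).2 v v' hvv)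
    · -- accept
      exact (unit _).2 hacc
  · intro H
    refine ⟨fun i b hb => ?_, ⟨?_, ?_, ?_⟩, fun j hj => ⟨?_, fun h0 => ?_⟩, fun j hj => ?_,
      fun t ht a r ha => ?_, fun t ht j hj h nb hh hnb => ?_, fun t ht r hr => ?_,
      fun t ht J hJ => ⟨?_, fun v v' hvv hboth => ?_⟩, ?_⟩
    · exact ⟨(unit _).1 (H _ (mem_clauses_bit x P T hb (by simp [bitClauses]))),
        (unit _).1 (H _ (mem_clauses_bit x P T hb (by simp [bitClauses])))⟩
    · exact (unit _).1 (H _ (mem_clauses_start x P T (by simp [startClauses])))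
    · exact (unit _).1 (H _ (mem_clauses_start x P T (by simp [startClauses])))
    · exact (unit _).1 (H _ (mem_clauses_start x P T (by simp [startClauses])))
    · -- a certificate block holds an input symbol or is empty
      have hmem : ([], [(β 0 (2 * n + 3 + j), symVal M false), (β 0 (2 * n + 3 + j), symVal M true),
          (β 0 (2 * n + 3 + j), noneVal M.tm)]) ∈ startClauses M n P T := by
        simp only [startClauses, List.mem_append, List.mem_flatMap, List.mem_range, List.mem_cons,
          List.mem_nil_iff, or_false]
        exact Or.inl (Or.inr ⟨j, hj, Or.inl rfl⟩)
      obtain ⟨v, hv, hτ⟩ := H _ (mem_clauses_start x P T hmem) (by simp)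
      simp only [List.mem_cons, List.mem_nil_iff, or_false] at hv
      rcases hv with rfl | rfl | rfl
      · exact Or.inl hτ
      · exact Or.inr (Or.inl hτ)
      · exact Or.inr (Or.inr hτ)
    · -- once empty, empty
      have hmem : ([(β 0 (2 * n + 3 + j), noneVal M.tm)], [(β 0 (2 * n + 4 + j), noneVal M.tm)]) ∈
          startClauses M n P T := by
        simp only [startClauses, List.mem_append, List.mem_flatMap, List.mem_range, List.mem_cons,
          List.mem_nil_iff, or_false]
        exact Or.inl (Or.inr ⟨j, hj, Or.inr rfl⟩)
      obtain ⟨v, hv, hτ⟩ := H _ (mem_clauses_start x P T hmem) (by simpa using h0)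
      simp only [List.mem_cons, List.mem_nil_iff, or_false] at hv
      subst hv; exact hτ
    · refine (unit _).1 (H _ (mem_clauses_start x P T ?_))
      simp only [startClauses, List.mem_append, List.mem_map, List.mem_range]
      exact Or.inr ⟨j, hj, rfl⟩
    · -- top rule
      have hmem : (((List.finRange (3 * d + 1)).map fun (s : Fin (3 * d + 1)) => (β t s, a s)),
          [(β (t + 1) r, topF d a r)]) ∈ topClauses M n P T t := by
        simp only [topClauses, List.mem_flatMap, List.mem_map]
        exact ⟨a, mem_allTuples M _, r, List.mem_finRange _, rfl⟩
      obtain ⟨v, hv, hτ⟩ := H _ (mem_clauses_top x P T ht hmem) (fun w hw => by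
        obtain ⟨s, -, rfl⟩ := List.mem_map.1 hw
        exact ha s)
      rw [List.mem_singleton] at hv
      subst hv; exact hτ
    · -- interior rule
      have hmem : ((((List.finRange (d + 1)).map fun (s : Fin (d + 1)) => (β t s, h s)) ++
          ((List.finRange (2 * d + 1)).map fun (s : Fin (2 * d + 1)) => (β t (d + 1 + j + s), nb s)),
          [(β (t + 1) (2 * d + 1 + j), intF d h nb)]) ∈ intClauses M n P T t j) := by
        simp only [intClauses, List.mem_flatMap, List.mem_map]
        exact ⟨h, mem_allTuples M _, nb, mem_allTuples M _, rfl⟩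
      obtain ⟨v, hv, hτ⟩ := H _ (mem_clauses_int x P T ht hj hmem) (fun w hw => by
        rcases List.mem_append.1 hw with hw | hw
        · obtain ⟨s, -, rfl⟩ := List.mem_map.1 hw
          exact hh s
        · obtain ⟨s, -, rfl⟩ := List.mem_map.1 hw
          exact hnb s)
      rw [List.mem_singleton] at hv
      subst hv; exact hτ
    · refine (unit _).1 (H _ (mem_clauses_bot x P T ht ?_))
      simp only [botClauses, List.mem_map, List.mem_range]
      exact ⟨r, hr, rfl⟩
    · -- at least one value
      have hmem : ([], (allVals M).map fun v => (β t J, v)) ∈ cellClauses M n P T t J := by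
        simp [cellClauses]
      obtain ⟨w, hw, hτ⟩ := H _ (mem_clauses_cell x P T ht hJ hmem) (by simp)
      obtain ⟨v, -, rfl⟩ := List.mem_map.1 hw
      exact ⟨v, hτ⟩
    · -- at most one value
      have hmem : ([(β t J, v), (β t J, v')], []) ∈ cellClauses M n P T t J := by
        simp only [cellClauses, List.mem_cons, List.mem_flatMap]
        refine Or.inr ⟨v, mem_allVals M _, v', mem_allVals M _, ?_⟩
        rw [if_neg hvv]; exact List.mem_singleton.2 rfl
      obtain ⟨w, hw, -⟩ := H _ (mem_clauses_cell x P T ht hJ hmem) (fun w hw => by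
        simp only [List.mem_cons, List.mem_nil_iff, or_false] at hw
        rcases hw with rfl | rfl
        · exact hboth.1
        · exact hboth.2)
      simp at hw
    · exact (unit _).1 (H _ (mem_clauses_acc x P T))

/-- **The families genuinely constrain `τ`**: the constant-`false` assignment violates the
accepting-block family `τ (β T 1, acc) = true`, so `ClausesHold M x P T` is a predicate to be
solved, never a valid closed statement (it has no closed discharge theorem). [folklore] -/
theorem not_clausesHold_const_false : ¬ ClausesHold M x P T (fun _ => false) := by
  rintro ⟨-, -, -, -, -, -, -, -, hacc⟩
  exact Bool.false_ne_true hacc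

/-- Hence, for every machine, input and bounds, some assignment violates the families.
[folklore] -/
theorem exists_not_clausesHold : ∃ τ : TVar M → Bool, ¬ ClausesHold M x P T τ :=
  ⟨fun _ => false, not_clausesHold_const_false M x P T⟩

/-- **Solvability of the families is acceptance of a short certificate** (if every run on a
certificate of length `≤ P` halts within `T` steps). [Sipser 2012, Thm. 7.37; Cook 1971, Thm. 1]
[folklore] -/
theorem exists_clausesHold_iff {f : List Bool → Bool}
    (hrun : ∀ u : List Bool, u.length ≤ P → M.OutputsWithin (boolPair x u) [f (boolPair x u)] T) :
    (∃ τ, ClausesHold M x P T τ) ↔ ∃ u : List Bool, u.length ≤ P ∧ f (boolPair x u) = true := by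
  rw [← satisfiable_tableau_iff x P T hrun]
  unfold tableau PropForm.Satisfiable tableauCNF
  exact exists_congr fun τ => by rw [HClause.eval_ofCNF_cnfOf, clausesHold_iff]

end Families

end Tableau

/-- The time bound of the tableau at input length `m` for certificate polynomial `p` and machine
polynomial `q`: `q (2m + 2 + p m)` (the longest verifier input). [folklore] -/
noncomputable def faginT (p q : Polynomial ℕ) (m : ℕ) : ℕ := q.eval (2 * m + 2 + p.eval m)

/-- **`NP` membership as solvability of the Cook–Levin families.** For `L ∈ NP` there are a
verifier machine `M` and polynomials `p` (certificate length) and `q` (running time) such that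
`x ∈ L` iff some assignment satisfies the clause families of `M` on `x` with bounds
`P = p |x|`, `T = q (2|x| + 2 + p |x|)`. [Sipser 2012, Thm. 7.37; Arora–Barak 2009, Thm. 2.10
with Def. 2.1] [folklore] -/
theorem exists_clausesHold_of_mem_NP {L : Language Bool} (hL : L ∈ Nondeterministic.NP) :
    ∃ (M : Turing.TM2ComputableAux Bool Bool) (p q : Polynomial ℕ), ∀ x : List Bool,
      x ∈ L ↔ ∃ τ, Tableau.ClausesHold M x (p.eval x.length) (faginT p q x.length) τ := by
  obtain ⟨L', hL', p, hp⟩ := hL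
  obtain ⟨q, M, hM⟩ := mem_P_iff_holds.1 hL'
  refine ⟨M, p, q, fun x => ?_⟩
  have hrun : ∀ u : List Bool, u.length ≤ p.eval x.length →
      M.OutputsWithin (boolPair x u) [(L' : Set (List Bool)).boolIndicator (boolPair x u)]
        (faginT p q x.length) := fun u hu =>
    (hM (boolPair x u)).mono (TM2Iter.eval_mono q (by
      change (boolPair x u).length ≤ _; rw [length_boolPair]; omega))
  rw [Tableau.exists_clausesHold_iff M x _ _ hrun, hp x]
  refine exists_congr fun u => and_congr Iff.rfl ?_
  exact Set.mem_iff_boolIndicator (L' : Set (List Bool)) (boolPair x u)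

end Literature.Computability.Complexity
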